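import Summits.NavierStokesRegularity.FluidComputer.GateBudgetCombMember
import HarnessLib

/-!
# What no tuning can beat, part 25a: THE PROFILE AT SECOND ORDER — at a general phase the exit
# is `|d(T)| = |sin φ|(1 - ψ²/2 … 1) ± |cos φ|ψ ± D`, and the cap and the floor hold behind ANY pin

Cell `pub-fluidc`, blueprint seat bp1 (gen 30, fourth item, first half); same namespace and
conventions as parts 1–24 (`GateBudget*.lean`); imports part 24a (`GateBudgetCombMember`: the
winding phase, and through it parts 22a, 17, 16). Modes `0 = a` input, `1 = b` clock,
`2 = c` catalyst (`u = c/ρ²`), `3 = d` transfer, `4 = ã` output; `σ_knob = ρ²/ε`.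
HONEST FRAMING (verbatim): low prior, high value-of-information experiment on Tao's machine
paradigm; NOT a claim that NS blows up.

THE POINT. Part 24's profile of the comb (`knob_member_profile`) is FIRST order in the phase
budget: `|sin Θ| ≥ |sin wπ| - ψ` (sin is 1-Lipschitz), which at the lattice and half-lattice
points loses to the SECOND-order pins of parts 17/20 (`|a(T)| ≥ 1 - ψ²/2 - D`) and 22a
(`|d(T)| ≥ 1 - ψ²/2 - D`) — honest limit (i) of part 24. This part removes it. §73: if the
total phase `Θ` is within `ψ` of an angle `φ`, then, writing `Θ = φ + δ` and expanding
`sin(φ + δ)`, `cos(φ + δ)` (`cos δ ≥ 1 - δ²/2 ≥ 1 - ψ²/2`, `|sin δ| ≤ |δ| ≤ ψ`),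
`|sin φ|(1 - ψ²/2) - |cos φ|ψ - D ≤ |d(T)| ≤ |sin φ| + |cos φ|ψ + D` and
`|cos φ|(1 - ψ²/2) - |sin φ|ψ - D ≤ |a(T)| ≤ |cos φ| + |sin φ|ψ + D` (`knob_phase_exit_sharp`;
`D` the drift of part 16's total tracking): the error is SECOND order along the circle and
first order only across it, weighted by the complementary coordinate. At `φ = kπ` this is
parts 17/20's pin, at `φ = (k + ½)π` part 22a's, at a general `φ` it sharpens part 24a's
`knob_phase_exit` from `± ψ` to `± (|·|ψ²/2 + |co-·|ψ)`. §74: the cap and the floor of part 24a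
§70 restated BEHIND AN ARBITRARY PIN — `ã(t)² ≤ 1 - L² + A` on `[0, T + β/(2ε)]` whenever
`0 ≤ L ≤ |a(T)|` (`knob_member_cap_of_pin`: part 17's output cap), and `ã(t) ≥ θ` for
`t ≥ T + β/(2ε)` whenever `0 ≤ L ≤ |d(T)|` and `θ ≤ K(L² - A′ - θ²)β/(2ε)`
(`knob_member_fire_of_pin`: part 22a's transfer freeze and drain) — so that any exit estimate,
this part's or a later one, feeds the same two mechanisms. Part 25b puts §73 and §74 together
with part 19's levels: the second-order profile, of which parts 20–24 at `M = K¹⁰` are cases.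

HONEST LIMITS. (i) `cos δ ≥ 1 - δ²/2` and `|sin δ| ≤ |δ|` are the only inputs: the bracket is
sharp to second order in `ψ` but not beyond. (ii) As in part 24: the cap holds on
`[0, T + β/(2ε)]` only and the floor from `T + β/(2ε)` on only; no second-pulse exclusion; the
floor is part 22a's LINEAR drain bound. (iii) Levels, `ψ`, `D`, `L`, `θ` are hypotheses here.
(iv) Nothing about Navier–Stokes.
[cite: Tao2016AveragedNS, §5.5 Theorem 5.3, (5.5), (5.6), (b-eq), (c-eq), (tcable)]
-/

noncomputable section

namespace Summit.NavierStokesRegularity.FluidComputer.GateBudget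

open Real Set Filter Topology
open Literature.Analysis.FluidPDE.Tao2016AveragedNS

variable {K M ε ρ : ℝ} {X : ℝ → Fin 5 → ℝ} {C : ℝ → ℝ}

/-! ## §73 The exit at a general phase, to second order -/

/-- **THE EXIT AT A GENERAL PHASE, TO SECOND ORDER.** If the total phase is within `ψ` of an
angle `φ`, `|Θ - φ| ≤ ψ`, then at clock death
`|sin φ|(1 - ψ²/2) - |cos φ|ψ - D ≤ |d(T)| ≤ |sin φ| + |cos φ|ψ + D` and
`|cos φ|(1 - ψ²/2) - |sin φ|ψ - D ≤ |a(T)| ≤ |cos φ| + |sin φ|ψ + D`, `D` the tracking drift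
of part 16 (`knob_total_tracking`): `Θ = φ + δ`, `|δ| ≤ ψ`, the addition formulas, and
`1 - ψ²/2 ≤ cos δ ≤ 1`, `|sin δ| ≤ ψ`. Sharpens part 24a's `knob_phase_exit` (`± ψ`); at
`φ ∈ (π/2)ℤ` it is parts 17/22a's second-order pins.
[cite: Tao2016AveragedNS, §5.5 Theorem 5.3, (5.5), (5.6)] -/
theorem knob_phase_exit_sharp (hX : ∀ t, HasDerivAt X (RotorKnob.rotorCircuit K M ε ρ (X t)) t)
    (h0 : X 0 = delayInit) (hC : ∀ t, HasDerivAt C (X t 2) t) (hε : 0 ≤ ε) (hK : 0 ≤ K)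
    {s₀ T : ℝ} (hs₀ : 0 ≤ s₀) (hsT : s₀ ≤ T) {φ ψ : ℝ}
    (hψ : |(C T - C 0) / ρ ^ 2 - φ| ≤ ψ) :
    (|sin φ| * (1 - ψ ^ 2 / 2) - |cos φ| * ψ - (4 * ((ε + ρ ^ 2 * exp (-M) + K * X s₀ 4) * s₀)
        + 2 * ((ε + ρ ^ 2 * exp (-M) + K * X T 4) * (T - s₀))) ≤ |X T 3| ∧
      |X T 3| ≤ |sin φ| + |cos φ| * ψ + (4 * ((ε + ρ ^ 2 * exp (-M) + K * X s₀ 4) * s₀)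
        + 2 * ((ε + ρ ^ 2 * exp (-M) + K * X T 4) * (T - s₀)))) ∧
    (|cos φ| * (1 - ψ ^ 2 / 2) - |sin φ| * ψ - (4 * ((ε + ρ ^ 2 * exp (-M) + K * X s₀ 4) * s₀)
        + 2 * ((ε + ρ ^ 2 * exp (-M) + K * X T 4) * (T - s₀))) ≤ |X T 0| ∧
      |X T 0| ≤ |cos φ| + |sin φ| * ψ + (4 * ((ε + ρ ^ 2 * exp (-M) + K * X s₀ 4) * s₀)
        + 2 * ((ε + ρ ^ 2 * exp (-M) + K * X T 4) * (T - s₀)))) := by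
  obtain ⟨td, ta⟩ := knob_total_tracking hX h0 hC hε hK hs₀ hsT
  set Θ := (C T - C 0) / ρ ^ 2 with hΘ
  set δ := Θ - φ with hδ
  -- the two inputs: `1 - ψ²/2 ≤ cos δ` and `|sin δ| ≤ ψ`
  have hcos : 1 - ψ ^ 2 / 2 ≤ |cos δ| := by
    have h1 := Real.one_sub_sq_div_two_le_cos (x := δ)
    have h2 : δ ^ 2 ≤ ψ ^ 2 := by
      rw [← sq_abs δ]
      exact pow_le_pow_left₀ (abs_nonneg _) hψ 2
    linarith [le_abs_self (cos δ)]
  have hsin : |sin δ| ≤ ψ := by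
    have h := Real.abs_sin_sub_sin_le δ 0
    rw [Real.sin_zero, sub_zero, sub_zero] at h
    exact h.trans hψ
  -- the second-order bracket of `p cos δ + q sin δ`
  have key : ∀ p q : ℝ, |p| * (1 - ψ ^ 2 / 2) - |q| * ψ ≤ |p * cos δ + q * sin δ| ∧
      |p * cos δ + q * sin δ| ≤ |p| + |q| * ψ := fun p q => by
    have hlo : |p * cos δ| - |q * sin δ| ≤ |p * cos δ + q * sin δ| := by
      have h := abs_add_le (p * cos δ + q * sin δ) (-(q * sin δ))
      rw [abs_neg, add_neg_cancel_right] at h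
      linarith
    have hhi : |p * cos δ + q * sin δ| ≤ |p * cos δ| + |q * sin δ| := abs_add_le _ _
    rw [abs_mul, abs_mul] at hlo hhi
    have h3 : |p| * (1 - ψ ^ 2 / 2) ≤ |p| * |cos δ| :=
      mul_le_mul_of_nonneg_left hcos (abs_nonneg _)
    have h4 : |q| * |sin δ| ≤ |q| * ψ := mul_le_mul_of_nonneg_left hsin (abs_nonneg _)
    have h5 : |p| * |cos δ| ≤ |p| := mul_le_of_le_one_right (abs_nonneg _) (abs_cos_le_one _)
    exact ⟨by linarith, by linarith⟩
  -- the addition formulas at `Θ = φ + δ`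
  have hΘφ : Θ = φ + δ := by rw [hδ]; ring
  have eS : sin φ * cos δ + cos φ * sin δ = sin Θ := by rw [hΘφ, Real.sin_add]
  have eC : cos φ * cos δ + -sin φ * sin δ = cos Θ := by rw [hΘφ, Real.cos_add]; ring
  have hS := key (sin φ) (cos φ)
  have hC' := key (cos φ) (-sin φ)
  rw [eS] at hS
  rw [eC, abs_neg] at hC'
  -- part 16's total tracking: `|d(T) - sin Θ|, |a(T) - cos Θ| ≤ D`
  have h1 := abs_le.1 ((abs_abs_sub_abs_le_abs_sub (X T 3) (sin Θ)).trans td)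
  have h3 := abs_le.1 ((abs_abs_sub_abs_le_abs_sub (X T 0) (cos Θ)).trans ta)
  exact ⟨⟨by linarith [h1.1, hS.1], by linarith [h1.2, hS.2]⟩,
    ⟨by linarith [h3.1, hC'.1], by linarith [h3.2, hC'.2]⟩⟩

/-! ## §74 The cap and the floor behind an arbitrary pin -/

/-- **THE CAP BEHIND A PIN.** Along `rotorCircuit K M ε ρ` from (5.6) (`0 < ρ² ≤ ε ≤ 1`,
`0 < M`, `0 ≤ K`), if the clock is dead at `T ≥ 0` (`b(T) ≤ -β < 0`), the catalyst residue is
`u(T) ≤ λ₀` and the carrier is pinned `|a(T)| ≥ L ≥ 0`, then for EVERY `t ∈ [0, T + β/(2ε)]`,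
`ã(t)² ≤ 1 - L² + 4ε(λ₀ + ε)/(Mβ) + 4e^{-M}/M` — part 17's output cap (`knob_output_cap`,
energy conservation behind the frozen carrier), monotone in the residue. Part 24a's
`knob_member_cap` is the pin `L = |cos wπ| - ψ - D`. [cite: Tao2016AveragedNS, §5.5 Theorem 5.3,
(energy-con)] -/
theorem knob_member_cap_of_pin (hX : ∀ t, HasDerivAt X (RotorKnob.rotorCircuit K M ε ρ (X t)) t)
    (h0 : X 0 = delayInit) (hε : 0 < ε) (hε1 : ε ≤ 1) (hρ : 0 < ρ) (hρε : ρ ^ 2 ≤ ε)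
    (hM : 0 < M) (hK : 0 ≤ K) {T β lam₀ L : ℝ} (hT : 0 ≤ T) (hβ : 0 < β) (hbT : X T 1 ≤ -β)
    (hcl : X T 2 ≤ lam₀ * ρ ^ 2) (hL : 0 ≤ L) (hpin : L ≤ |X T 0|) {t : ℝ}
    (ht : t ∈ Icc 0 (T + β / (2 * ε))) :
    X t 4 ^ 2 ≤ 1 - L ^ 2 + (4 * ε * (lam₀ + ε) / (M * β) + 4 * exp (-M) / M) := by
  have hcap := knob_output_cap hX h0 hε hε1 hρ hρε hM hK hT hβ hbT ht
  have hsqa : L ^ 2 ≤ X T 0 ^ 2 := by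
    rw [← sq_abs (X T 0)]
    exact pow_le_pow_left₀ hL hpin 2
  -- the afterglow is monotone in `u(T) ≤ λ₀`
  have hu : X T 2 / ρ ^ 2 ≤ lam₀ := by rwa [div_le_iff₀ (by positivity)]
  have hMβ : 0 < M * β := by positivity
  have hA : 4 * ε * (X T 2 / ρ ^ 2 + ε) / (M * β) ≤ 4 * ε * (lam₀ + ε) / (M * β) :=
    div_le_div_of_nonneg_right (mul_le_mul_of_nonneg_left (by linarith) (by positivity)) hMβ.le
  linarith

/-- **THE FLOOR BEHIND A PIN.** Along `rotorCircuit K M ε ρ` from (5.6) (`0 < ε`, `0 < ρ`,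
`0 < M`, `0 ≤ K`), if the clock is dead at `T ≥ 0` (`b(T) ≤ -β < 0`), the catalyst residue is
`u(T) ≤ λ₀` and the transfer mode is pinned `|d(T)| ≥ L ≥ 0`, then for every `θ ≥ 0` with
`θ ≤ K(L² - A′ - θ²)·β/(2ε)`, `A′ = 2ελ₀/(Mβ) + e^{-M}/M`, the output satisfies `ã(t) ≥ θ` for
all `t ≥ T + β/(2ε)` — part 22a's transfer freeze (`knob_transfer_freeze_selftimed`) holds
`d² + ã² ≥ L² - A′` on the self-timed window and its drain (`knob_drain_fires`) converts it.
Part 24a's `knob_member_fire` is the pin `L = |sin wπ| - ψ - D`.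
[cite: Tao2016AveragedNS, §5.5 Theorem 5.3, (b-eq), (c-eq), (tcable)] -/
theorem knob_member_fire_of_pin
    (hX : ∀ t, HasDerivAt X (RotorKnob.rotorCircuit K M ε ρ (X t)) t) (h0 : X 0 = delayInit)
    (hε : 0 < ε) (hρ : 0 < ρ) (hM : 0 < M) (hK : 0 ≤ K) {T β lam₀ L θ : ℝ} (hT : 0 ≤ T)
    (hβ : 0 < β) (hbT : X T 1 ≤ -β) (hcl : X T 2 ≤ lam₀ * ρ ^ 2) (hL : 0 ≤ L)
    (hpin : L ≤ |X T 3|) (hθ : 0 ≤ θ)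
    (hfire : θ ≤ K * (L ^ 2 - (2 * ε * lam₀ / (M * β) + exp (-M) / M) - θ ^ 2)
      * (β / (2 * ε))) :
    ∀ t, T + β / (2 * ε) ≤ t → θ ≤ X t 4 := by
  -- at clock death the output pair holds at least `d(T)² ≥ L²`
  have hsqd : L ^ 2 ≤ X T 3 ^ 2 := by
    rw [← sq_abs (X T 3)]
    exact pow_le_pow_left₀ hL hpin 2
  have hu : X T 2 / ρ ^ 2 ≤ lam₀ := by rwa [div_le_iff₀ (by positivity)]
  have hMβ : 0 < M * β := by positivity
  have hA : 2 * ε * (X T 2 / ρ ^ 2) / (M * β) ≤ 2 * ε * lam₀ / (M * β) :=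
    div_le_div_of_nonneg_right (mul_le_mul_of_nonneg_left hu (by positivity)) hMβ.le
  -- part 22a §62: the pair is frozen above `L² - A′` on the self-timed window
  have hfz : ∀ t ∈ Icc T (T + β / (2 * ε)),
      L ^ 2 - (2 * ε * lam₀ / (M * β) + exp (-M) / M) ≤ X t 3 ^ 2 + X t 4 ^ 2 := fun t ht => by
    have h := knob_transfer_freeze_selftimed hX h0 hε hρ hM hT hβ hbT ht
    nlinarith [sq_nonneg (X T 4)]
  -- part 22a §63: the drain fires on it
  have hwin : T ≤ T + β / (2 * ε) := by
    have : 0 ≤ β / (2 * ε) := by positivity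
    linarith
  have hfire' : θ ≤ K * (L ^ 2 - (2 * ε * lam₀ / (M * β) + exp (-M) / M) - θ ^ 2)
      * (T + β / (2 * ε) - T) := by
    have : T + β / (2 * ε) - T = β / (2 * ε) := by ring
    rw [this]; exact hfire
  exact knob_drain_fires hX hK hwin (RotorKnob.e_nonneg hX h0 hK hT) hθ hfz hfire'

end Summit.NavierStokesRegularity.FluidComputer.GateBudget
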